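import Literature.Analysis.FluidPDE.DifferentiableGaussGreen
import Literature.Analysis.FluidPDE.LeiZhang2011RegularityProofs
import Literature.Analysis.FluidPDE.BallCutoff
import Literature.Analysis.FunctionSpaces.BMOCarlesonProofs
import HarnessLib

/-!
# Lei–Zhang 2011, Theorem 1.4: pairing a `BMO` stream function with a plateau cut-off
# (the scale-invariant estimate behind the endgame)

Analysis/FluidPDE **proofs file** (theorems only: no definitions, no named facts, no `sorry`) on
the discharge path of the named fact
`Literature.Analysis.FluidPDE.LeiZhang2011_regularity_bmoStream` (Z. Lei, Q. S. Zhang,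
J. Funct. Anal. 261 (2011) 2323–2345 = arXiv:1011.5066, **Theorem 1.4**, proof §4 pp. 12–13),
third file after `DifferentiableGaussGreen.lean` and `LeiZhang2011RegularityProofs.lean`; the
limit passage built on it is `LeiZhang2011BlowupEndgame.lean`.

The printed proof blows up at a singular point: `v^{(k)}(x, t) = Q_k⁻¹ v(x_k + x/Q_k, t_k + t/Q_k²)`
converges "in `L^∞(Ω)` for any compact `Ω`" to a bounded ancient solution `u`, which in both
cases turns out to be constant in space and is then killed by the `BMO` stream function: "both
the stream function and `r v^θ` are scaling invariant. Thus the stream function of `u` is in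
BMO" (p. 12) … "the boundedness of the stream function of `u` in BMO norm implies that `u = 0`"
(p. 13). Read literally this needs a stream function *of the limit*, i.e. compactness for
`BMO`-bounded sequences of stream functions. The tree's endgame avoids it: the only use of the
stream bound is the following estimate against the plateaux `φ_R = ballCutoff x₀ R` (`= 1` on
`B̄(x₀, 2R)`, supported in `B̄(x₀, 3R)`, `‖∇φ_R‖ ≤ C₀/R`), which sees `B` only through
`‖B‖_{BMO}` — invariant under the rescaling `B ↦ B(x_k + ·/Q_k)` of the stream function
(`eBMOSeminormVec_comp_smul`) — and therefore holds uniformly along the blow-up sequence: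

* `exists_abs_integral_inner_cross_gradient_ballCutoff_le` — for `B` locally integrable with
  `‖B‖_{BMO} ≤ K` (`eBMOSeminormVec`): `|∫ ⟪B × ∇φ_R, e⟫| ≤ A K ‖e‖ R²` with an absolute `A`
  (subtract the vector of ball averages of the components over `B(x₀, 4R)` using `∫ ∇φ_R = 0`;
  then `‖∇φ_R‖ ≤ C₀/R` and `∫_{B(x₀,4R)} |Bᵢ − (Bᵢ)_B| ≤ K |B(x₀, 4R)|`);
* `exists_abs_integral_ballCutoff_mul_inner_le` — hence `|∫ φ_R ⟪w, e⟫| ≤ A K ‖e‖ R²` whenever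
  `curl B = w` a.e. for a differentiable `B` with `‖B‖_{BMO} ≤ K` (through the distributional
  curl identity `integral_mul_inner_eq_integral_inner_cross_gradient`);
* pointwise helpers `abs_inner_le_sum_abs_mul_norm`, `apply_eq_inner_single`.

## Mathlib / tree search

Reused: `ballCutoff`, `contDiff_ballCutoff`, `hasCompactSupport_ballCutoff`,
`exists_norm_fderiv_ballCutoff_le`, `ballCutoff_eventuallyEq_zero` (`BallCutoff`);
`MemBMO.setIntegral_norm_sub_average_le` (`BMOCarlesonProofs`);
`memBMO_inner_of_eBMOSeminormVec_lt_top` (`LeiZhang2011RegularityProofs`);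
`integral_mul_inner_eq_integral_inner_cross_gradient`, `inner_cross_left_swap`,
`inner_cross_right_eq_inner_cross_left` (`DifferentiableGaussGreen`);
`integral_fderiv_apply_eq_zero`, `continuous_gradient_of_contDiff`,
`gradient_eq_zero_of_notMem_tsupport` (`WholeSpaceIBP`); `inner_gradient_left`
(`BiotSavartCurlPair`); Mathlib `Measure.addHaar_ball_of_pos`, `norm_cross`.
`lean search 'ballCutoff.*BMO'`: nothing prior; the axial-constant, single-field version of the
estimate is inside the proof of `eq_zero_of_ae_curl_apply_two_eq_of_eBMOSeminormVec_le`
(`LeiZhang2011Proofs`).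

## References

* Z. Lei, Q. S. Zhang, *A Liouville theorem for the axially-symmetric Navier–Stokes equations*,
  J. Funct. Anal. 261 (2011) 2323–2345 = arXiv:1011.5066: Thm. 1.4 (p. 4), proof §4, Cases 1–2
  (pp. 12–13). [LeiZhang2011]
-/

noncomputable section

open MeasureTheory Set Function Filter Topology TopologicalSpace Metric
open scoped InnerProductSpace RealInnerProductSpace NNReal ENNReal

namespace Literature.Analysis.FluidPDE

open Literature.Analysis.FunctionSpaces

/-! ### Pointwise inequalities on `ℝ³` -/

/-- `|⟪a, b⟫| ≤ (Σᵢ |aᵢ|) ‖b‖` on `ℝ³` (the `ℓ¹`–`ℓ^∞` bound and `|bᵢ| ≤ ‖b‖`). [folklore] -/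
theorem abs_inner_le_sum_abs_mul_norm (a b : EuclideanSpace ℝ (Fin 3)) :
    |⟪a, b⟫| ≤ (∑ i, |a i|) * ‖b‖ := by
  have h : ⟪a, b⟫ = ∑ i, a i * b i := by
    simp [PiLp.inner_apply, mul_comm]
  rw [h, Finset.sum_mul]
  refine (Finset.abs_sum_le_sum_abs _ _).trans (Finset.sum_le_sum fun i _ => ?_)
  rw [abs_mul]
  gcongr
  simpa [Real.norm_eq_abs] using PiLp.norm_apply_le b i

/-- `‖v × w‖ ≤ ‖v‖ ‖w‖` (a private copy of `norm_cross_le` of `PoincareHomotopyOperatorL2`,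
which is not imported here). [folklore] -/
private theorem norm_cross_le' (v w : EuclideanSpace ℝ (Fin 3)) : ‖cross v w‖ ≤ ‖v‖ * ‖w‖ := by
  rw [norm_cross]
  have h1 : Real.sin (InnerProductGeometry.angle v w) ≤ 1 := Real.sin_le_one _
  have h0 : 0 ≤ ‖v‖ * ‖w‖ := by positivity
  nlinarith

/-- A component `x ↦ B x i` of a field is the pairing with the unit vector `eᵢ`. [folklore] -/
theorem apply_eq_inner_single (v : EuclideanSpace ℝ (Fin 3)) (i : Fin 3) :
    v i = ⟪v, EuclideanSpace.single i (1 : ℝ)⟫ := by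
  rw [EuclideanSpace.inner_single_right]
  simp

/-! ### The core estimate: pairing a `BMO` field with the gradient of a plateau cut-off -/

/-- **Pairing a `BMO` field with `∇φ_R`.** There is an absolute constant `A ≥ 0` such that for
every locally integrable `B : ℝ³ → ℝ³` with `‖B‖_{BMO} ≤ K` (`eBMOSeminormVec`), every centre
`x₀`, radius `R > 0` and vector `e`,
`|∫ ⟪B × ∇φ_R, e⟫| ≤ A K ‖e‖ R²` for the plateau cut-off `φ_R = ballCutoff x₀ R` (`= 1` on
`B̄(x₀, 2R)`, supported in `B̄(x₀, 3R)`, `‖∇φ_R‖ ≤ C₀/R`). Proof: `∫ ∇φ_R = 0` lets one replace `B`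
by `B − c` with `c` the vector of ball averages of the components of `B` over `B(x₀, 4R)`; then
`|∫ ⟪(B − c) × ∇φ_R, e⟫| ≤ (C₀/R) ‖e‖ Σᵢ ∫_{B(x₀,4R)} |Bᵢ − cᵢ| ≤ (C₀/R) ‖e‖ · 3 K |B(x₀, 4R)|`.
This is the estimate behind the last step of both cases of the printed proof of Lei–Zhang's
Theorem 1.4 ("the boundedness of the stream function of `u` in BMO norm implies that `u = 0`",
arXiv:1011.5066 p. 13), in a form that is uniform along a blow-up sequence.
[cite: LeiZhang2011, Thm. 1.4, proof §4 (arXiv pp. 12–13)] -/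
theorem exists_abs_integral_inner_cross_gradient_ballCutoff_le :
    ∃ A : ℝ, 0 ≤ A ∧ ∀ (B : EuclideanSpace ℝ (Fin 3) → EuclideanSpace ℝ (Fin 3)),
      LocallyIntegrable B volume → ∀ (K : ℝ≥0), eBMOSeminormVec B ≤ K →
      ∀ (x₀ : EuclideanSpace ℝ (Fin 3)) (R : ℝ), 0 < R → ∀ e : EuclideanSpace ℝ (Fin 3),
        |∫ x, ⟪cross (B x) (gradient (ballCutoff x₀ R) x), e⟫| ≤ A * K * ‖e‖ * R ^ 2 := by
  obtain ⟨C₀, hC₀, hD⟩ := exists_norm_fderiv_ballCutoff_le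
  set V₁ : ℝ := volume.real (ball (0 : EuclideanSpace ℝ (Fin 3)) 1) with hV₁
  have hV₁0 : 0 ≤ V₁ := measureReal_nonneg
  refine ⟨3 * 64 * C₀ * V₁, by positivity, fun B hBi K hK x₀ R hR e => ?_⟩
  -- the cut-off and its gradient
  set φ : EuclideanSpace ℝ (Fin 3) → ℝ := ballCutoff x₀ R with hφ
  have hφ1 : ContDiff ℝ 1 φ := contDiff_ballCutoff x₀ R
  have hφc : HasCompactSupport φ := hasCompactSupport_ballCutoff hR
  set g : EuclideanSpace ℝ (Fin 3) → EuclideanSpace ℝ (Fin 3) := gradient φ with hg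
  have hgc : Continuous g := continuous_gradient_of_contDiff hφ1
  have hg_norm : ∀ x, ‖g x‖ ≤ C₀ / R := fun x => by
    rw [hg, gradient, LinearIsometryEquiv.norm_map]
    exact hD x₀ R hR x
  have hg_zero : ∀ x, x ∉ closedBall x₀ (3 * R) → g x = 0 := fun x hx => by
    have h0 : x ∉ tsupport φ :=
      notMem_tsupport_iff_eventuallyEq.2 (ballCutoff_eventuallyEq_zero hR hx)
    exact gradient_eq_zero_of_notMem_tsupport h0
  -- the components of `B` and their ball averages over `B(x₀, 4R)`
  have h4R : 0 < 4 * R := by linarith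
  set comp : Fin 3 → EuclideanSpace ℝ (Fin 3) → ℝ :=
    fun i x => ⟪B x, EuclideanSpace.single i (1 : ℝ)⟫ with hcomp
  have hcomp_eq : ∀ i x, B x i = comp i x := fun i x => apply_eq_inner_single (B x) i
  have hBMOi : ∀ i, MemBMO (comp i) volume := fun i =>
    memBMO_inner_of_eBMOSeminormVec_lt_top hBi (hK.trans_lt ENNReal.coe_lt_top) _
  have hsemi : ∀ i, (eBMOSeminorm (comp i) volume).toReal ≤ K := fun i => by
    have h1 : eBMOSeminorm (comp i) volume ≤ eBMOSeminormVec B :=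
      le_iSup₂_of_le (EuclideanSpace.single i (1 : ℝ)) (by simp) le_rfl
    have h2 := ENNReal.toReal_mono ENNReal.coe_ne_top (h1.trans hK)
    simpa using h2
  set cᵢ : Fin 3 → ℝ := fun i => ⨍ z in ball x₀ (4 * R), comp i z with hcᵢ
  set c : EuclideanSpace ℝ (Fin 3) := WithLp.toLp 2 cᵢ with hc
  have hc_apply : ∀ i, c i = cᵢ i := fun i => rfl
  -- oscillation bound of each component
  have hosc : ∀ i, ∫ y in ball x₀ (4 * R), ‖comp i y - cᵢ i‖ ≤ K * ((4 * R) ^ 3 * V₁) := by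
    intro i
    have h := (hBMOi i).setIntegral_norm_sub_average_le x₀ h4R
    have hvol : volume.real (ball x₀ (4 * R)) = (4 * R) ^ 3 * V₁ := by
      simp only [hV₁, Measure.real]
      rw [Measure.addHaar_ball_of_pos volume x₀ h4R, finrank_euclideanSpace_fin,
        ENNReal.toReal_mul, ENNReal.toReal_ofReal (pow_nonneg h4R.le 3)]
    rw [hvol] at h
    refine h.trans ?_
    gcongr
    exact hsemi i
  -- Step A: subtract the constant vector `c`
  have hconst : ∫ x, ⟪cross c (g x), e⟫ = 0 := by
    have hpt : ∀ x, ⟪cross c (g x), e⟫ = fderiv ℝ φ x (-(cross c e)) := fun x => by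
      rw [inner_cross_left_swap, real_inner_comm, ← inner_neg_right, hg,
        FluidPDE.inner_gradient_left]
    simp_rw [hpt]
    exact integral_fderiv_apply_eq_zero hφ1 hφc _
  -- integrability of the two pairings
  have hBc : AEStronglyMeasurable (fun x => B x - c) volume :=
    hBi.aestronglyMeasurable.sub aestronglyMeasurable_const
  have hI₂_meas : AEStronglyMeasurable (fun x => ⟪cross (B x - c) (g x), e⟫) volume := by
    have hcont : Continuous
        (Function.uncurry fun a b : EuclideanSpace ℝ (Fin 3) => ⟪cross a b, e⟫) :=
      (crossCLM.continuous₂.inner continuous_const)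
    exact hcont.comp_aestronglyMeasurable₂ hBc hgc.aestronglyMeasurable
  have hgs : HasCompactSupport g :=
    HasCompactSupport.intro (isCompact_closedBall x₀ (3 * R)) fun x hx => hg_zero x hx
  have hmaj : Integrable (fun x => (‖g x‖ * ‖e‖) • ‖B x - c‖) := by
    have hloc : LocallyIntegrable (fun x => ‖B x - c‖) volume :=
      (hBi.sub (locallyIntegrable_const c)).mono hBc.norm
        (Eventually.of_forall fun x => by simp)
    exact hloc.integrable_smul_left_of_hasCompactSupport (hgc.norm.mul continuous_const)
      (hgs.norm.mul_right)
  have hI₂_bound : ∀ x, ‖⟪cross (B x - c) (g x), e⟫‖ ≤ (‖g x‖ * ‖e‖) • ‖B x - c‖ := fun x => by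
    rw [smul_eq_mul, Real.norm_eq_abs]
    calc |⟪cross (B x - c) (g x), e⟫| ≤ ‖cross (B x - c) (g x)‖ * ‖e‖ := abs_real_inner_le_norm _ _
      _ ≤ ‖B x - c‖ * ‖g x‖ * ‖e‖ := by gcongr; exact norm_cross_le' _ _
      _ = ‖g x‖ * ‖e‖ * ‖B x - c‖ := by ring
  have hI₂ : Integrable (fun x => ⟪cross (B x - c) (g x), e⟫) :=
    hmaj.mono' hI₂_meas (Eventually.of_forall hI₂_bound)
  have hI₃c : Continuous fun x => ⟪cross c (g x), e⟫ :=
    (crossCLM.continuous₂.comp₂ continuous_const hgc).inner continuous_const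
  have hI₃s : HasCompactSupport fun x => ⟪cross c (g x), e⟫ :=
    HasCompactSupport.intro (isCompact_closedBall x₀ (3 * R)) fun x hx => by
      simp [hg_zero x hx, ← crossCLM_apply]
  have hI₃ : Integrable (fun x => ⟪cross c (g x), e⟫) := hI₃c.integrable_of_hasCompactSupport hI₃s
  have hsplit : ∫ x, ⟪cross (B x) (g x), e⟫ = ∫ x, ⟪cross (B x - c) (g x), e⟫ := by
    have hpt : ∀ x, ⟪cross (B x) (g x), e⟫ = ⟪cross (B x - c) (g x), e⟫ + ⟪cross c (g x), e⟫ :=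
      fun x => by
        rw [← inner_add_left]
        congr 1
        simp [← crossCLM_apply, map_sub]
    simp_rw [hpt]
    rw [integral_add hI₂ hI₃, hconst, add_zero]
  -- Step B: the `BMO` bound
  rw [hsplit]
  have hstep1 : |∫ x, ⟪cross (B x - c) (g x), e⟫| ≤
      ∫ x, (C₀ / R * ‖e‖) *
        (closedBall x₀ (3 * R)).indicator (fun x => ∑ i, |comp i x - cᵢ i|) x := by
    refine (abs_integral_le_integral_abs).trans (integral_mono hI₂.abs ?_ fun x => ?_)
    · refine Integrable.const_mul ?_ _
      refine IntegrableOn.integrable_indicator ?_ measurableSet_closedBall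
      refine integrable_finsetSum _ fun i _ => ?_
      exact (((hBMOi i).locallyIntegrable.integrableOn_isCompact
        (isCompact_closedBall x₀ (3 * R))).sub
          (integrableOn_const (measure_closedBall_lt_top).ne)).abs
    · dsimp only
      by_cases hx : x ∈ closedBall x₀ (3 * R)
      · rw [indicator_of_mem hx, ← inner_cross_right_eq_inner_cross_left]
        calc |⟪B x - c, cross (g x) e⟫| ≤ (∑ i, |(B x - c) i|) * ‖cross (g x) e‖ :=
              abs_inner_le_sum_abs_mul_norm _ _
          _ ≤ (∑ i, |comp i x - cᵢ i|) * (C₀ / R * ‖e‖) := by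
              have h1 : (∑ i, |(B x - c) i|) = ∑ i, |comp i x - cᵢ i| :=
                Finset.sum_congr rfl fun i _ => by rw [PiLp.sub_apply, hcomp_eq, hc_apply]
              have h2 : ‖cross (g x) e‖ ≤ C₀ / R * ‖e‖ :=
                (norm_cross_le' _ _).trans (mul_le_mul_of_nonneg_right (hg_norm x) (norm_nonneg _))
              rw [h1]
              exact mul_le_mul_of_nonneg_left h2 (Finset.sum_nonneg fun i _ => abs_nonneg _)
          _ = C₀ / R * ‖e‖ * ∑ i, |comp i x - cᵢ i| := by ring
      · rw [indicator_of_notMem hx, hg_zero x hx]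
        simp [← crossCLM_apply]
  refine hstep1.trans ?_
  rw [integral_const_mul, integral_indicator measurableSet_closedBall]
  -- enlarge `B̄(x₀, 3R)` to `B(x₀, 4R)` and sum the oscillation bounds
  have hsub : closedBall x₀ (3 * R) ⊆ ball x₀ (4 * R) :=
    closedBall_subset_ball (by linarith)
  have hint4 : ∀ i, IntegrableOn (fun x => |comp i x - cᵢ i|) (ball x₀ (4 * R)) := by
    intro i
    have h1 : IntegrableOn (fun x => comp i x - cᵢ i) (closedBall x₀ (4 * R)) :=
      ((hBMOi i).locallyIntegrable.integrableOn_isCompact (isCompact_closedBall x₀ (4 * R))).sub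
        (integrableOn_const (measure_closedBall_lt_top).ne)
    exact (h1.mono_set ball_subset_closedBall).abs
  have hstep2 : ∫ x in closedBall x₀ (3 * R), ∑ i, |comp i x - cᵢ i| ≤
      ∫ x in ball x₀ (4 * R), ∑ i, |comp i x - cᵢ i| :=
    setIntegral_mono_set (integrable_finsetSum _ fun i _ => hint4 i)
      (Eventually.of_forall fun x => Finset.sum_nonneg fun i _ => abs_nonneg _)
      (Eventually.of_forall hsub)
  have hstep3 : ∫ x in ball x₀ (4 * R), ∑ i, |comp i x - cᵢ i| ≤ 3 * (K * ((4 * R) ^ 3 * V₁)) := by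
    rw [integral_finsetSum _ fun i _ => hint4 i]
    calc ∑ i, ∫ x in ball x₀ (4 * R), |comp i x - cᵢ i|
        ≤ ∑ _i : Fin 3, K * ((4 * R) ^ 3 * V₁) := Finset.sum_le_sum fun i _ => by
          simpa only [Real.norm_eq_abs] using hosc i
      _ = 3 * (K * ((4 * R) ^ 3 * V₁)) := by simp
  have hCe : 0 ≤ C₀ / R * ‖e‖ := by positivity
  calc C₀ / R * ‖e‖ * ∫ x in closedBall x₀ (3 * R), ∑ i, |comp i x - cᵢ i|
      ≤ C₀ / R * ‖e‖ * (3 * (K * ((4 * R) ^ 3 * V₁))) :=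
        mul_le_mul_of_nonneg_left (hstep2.trans hstep3) hCe
    _ = 3 * 64 * C₀ * V₁ * K * ‖e‖ * R ^ 2 := by
        field_simp
        ring


/-- **The same estimate for the distributional curl of a differentiable field.** There is an
absolute `A ≥ 0` such that: if `B : ℝ³ → ℝ³` is differentiable, `curl B = w` a.e. with `w`
locally integrable, and `‖B‖_{BMO} ≤ K`, then `|∫ φ_R ⟪w, e⟫| ≤ A K ‖e‖ R²` for every centre,
radius `R > 0` and vector `e` (`φ_R = ballCutoff x₀ R`). The bound sees `B` only through
`‖B‖_{BMO}`, which is invariant under the Navier–Stokes rescaling of the stream function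
(`eBMOSeminormVec_comp_smul`), so it holds uniformly along a blow-up sequence ("both the stream
function and `r v^θ` are scaling invariant", arXiv:1011.5066 p. 12).
[cite: LeiZhang2011, Thm. 1.4, proof §4, Case 1 (arXiv p. 12)] -/
theorem exists_abs_integral_ballCutoff_mul_inner_le :
    ∃ A : ℝ, 0 ≤ A ∧ ∀ (B w : EuclideanSpace ℝ (Fin 3) → EuclideanSpace ℝ (Fin 3)),
      Differentiable ℝ B → curl B =ᵐ[volume] w → LocallyIntegrable w volume →
      ∀ (K : ℝ≥0), eBMOSeminormVec B ≤ K →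
      ∀ (x₀ : EuclideanSpace ℝ (Fin 3)) (R : ℝ), 0 < R → ∀ e : EuclideanSpace ℝ (Fin 3),
        |∫ x, ballCutoff x₀ R x * ⟪w x, e⟫| ≤ A * K * ‖e‖ * R ^ 2 := by
  obtain ⟨A, hA, h⟩ := exists_abs_integral_inner_cross_gradient_ballCutoff_le
  refine ⟨A, hA, fun B w hB hcurl hw K hK x₀ R hR e => ?_⟩
  rw [integral_mul_inner_eq_integral_inner_cross_gradient hB hcurl hw (contDiff_ballCutoff x₀ R)
    (hasCompactSupport_ballCutoff hR) e]
  exact h B hB.continuous.locallyIntegrable K hK x₀ R hR e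

end Literature.Analysis.FluidPDE
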